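import Mathlib
import Summits.ValiantsHypothesis.ValiantsHypothesis.Theorems.LacunarySymmetroidMatrixDescartesCensusWindowFourWitnessParam

/-!
# `MatrixDescartes` census — WINDOW-4 witness rows WITH MULTIPLICITY (the form the hull-edge certificates need)

HONEST FRAMING.  Object-search cell `pub-symmetroid`, door-A target `DoorA26 := PosRootLawAt 2 6 19`
(stmt-ValiantsHypothesis-19979; OPEN, typed, never asserted).  Companion of `…CensusWindowFourWitnessCentre` /
`…CensusWindowFourWitnessParam` (val-sym-door-p1 g9).  There the left centre witness (`r` at or left of the common centre of
`T₂` and `Φ`, `T₂(r) < 0`, `Φ(r) > 0`) bounds the number of DISTINCT positive roots of the alternating window 4-nomial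
`g = a − b x^u + c x^(u+v) − e x^(u+v+w)` by two.  The hull-edge («channel») certificates of the boundary layer count positive roots
WITH MULTIPLICITY (`roots.countP`), because a hull-edge form is a limit of Descartes-sharp pencils.  This file supplies that form:

* `fourNomial_rootMultiplicity_le_one_of_left_centre_witness` — under the left centre witness EVERY positive root of `g` is simple.
  Proof: at a multiple root `x`, `g(x) = g′(x) = 0`, hence `Φ(x) = u·g(x) − x·g′(x) = 0` and `T₂(x) = −x^(1−u) g′(x) = 0`;
  if `x ≤ r`, `Φ` is antitone on `[0, r]` so `Φ(x) ≥ Φ(r) > 0`; if `x > r`, either `x ≤ m` (the common centre) and `T₂` antitone on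
  `[0, m]` gives `T₂(x) ≤ T₂(r) < 0`, or `x > m` and `T₂ ≤ 0` on `[r, x]` (antitone then monotone up to the zero `x`) makes `g`
  non-decreasing on `[r, x]`, so `0 = g(x) ≥ g(r) = (Φ(r) − r^u T₂(r))/u > 0`.
* `countP_posRoots_le_card_posRoots_of_rootMultiplicity_le_one` — bookkeeping: simple positive roots ⇒ `countP = card`.
* `fourNomial_countP_posRoots_le_two_of_left_centre_witness`, `fourNomial_countP_posRoots_le_two_of_left_param` — the
  multiplicity versions of the centre / parametric LEFT rows (same hypotheses as the distinct-root theorems, plus `0 < c`).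

Read contrapositively, for every `λ > 1` a window 4-nomial with at least three positive roots counted with multiplicity satisfies the
DISJUNCTION of the negations of the three monomial rows — the log-linear two-way split («row A ∨ row B») used by the engine-2 g30
located instrument hybrid32 on the boundary long edges of chamber 1706.  Nothing here bounds any census count; `DoorA26` OPEN; nothing
on `MatrixDescartes` (stmt-ValiantsHypothesis-18050) or `VP ≠ VNP`.

[folklore] Rolle with multiplicity for a one-variable fewnomial; elementary.
-/

-- `Summit.ValiantsHypothesis.ValiantsHypothesis.…` repeats a component by the D-0017 layout
-- (single-conjunct summit), which the `dupNamespace` linter flags; the name is mandated.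
set_option linter.dupNamespace false

namespace Summit.ValiantsHypothesis.ValiantsHypothesis.Theorems.LacunarySymmetroidMatrixDescartes.Census

open Polynomial Finset Set
open scoped BigOperators Polynomial

/-- `x · (d/dx)(c·x^n) = c·n·x^n` at the level of polynomial evaluation (all `n`, including `n = 0`). [folklore] -/
theorem mul_eval_derivative_C_mul_X_pow' (c x : ℝ) (n : ℕ) :
    x * (derivative (C c * X ^ n)).eval x = c * (n : ℝ) * x ^ n := by
  rw [derivative_C_mul_X_pow, eval_mul, eval_C, eval_pow, eval_X]
  rcases Nat.eq_zero_or_pos n with rfl | hn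
  · simp
  · have : x ^ n = x ^ (n - 1) * x := by rw [← pow_succ, Nat.sub_add_cancel hn]
    rw [this]; ring

/-- Evaluation of the window 4-nomial. [folklore] -/
theorem eval_fourNomial (a b c e : ℝ) (u v w : ℕ) (x : ℝ) :
    (C a - C b * X ^ u + C c * X ^ (u + v) - C e * X ^ (u + v + w)).eval x
      = a - b * x ^ u + c * x ^ (u + v) - e * x ^ (u + v + w) := by
  simp only [eval_sub, eval_add, eval_mul, eval_C, eval_pow, eval_X]

/-- `x · g′(x)` for the window 4-nomial `g`. [folklore] -/
theorem mul_eval_derivative_fourNomial (a b c e : ℝ) (u v w : ℕ) (x : ℝ) :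
    x * (derivative (C a - C b * X ^ u + C c * X ^ (u + v) - C e * X ^ (u + v + w))).eval x
      = -(b * (u : ℝ) * x ^ u) + c * ((u : ℝ) + v) * x ^ (u + v) - e * ((u : ℝ) + v + w) * x ^ (u + v + w) := by
  have h1 := mul_eval_derivative_C_mul_X_pow' b x u
  have h2 := mul_eval_derivative_C_mul_X_pow' c x (u + v)
  have h3 := mul_eval_derivative_C_mul_X_pow' e x (u + v + w)
  push_cast at h2 h3
  have hd : derivative (C a - C b * X ^ u + C c * X ^ (u + v) - C e * X ^ (u + v + w))
      = -derivative (C b * X ^ u) + derivative (C c * X ^ (u + v)) - derivative (C e * X ^ (u + v + w)) := by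
    simp only [derivative_sub, derivative_add, derivative_C, zero_sub]
  rw [hd, eval_sub, eval_add, eval_neg, mul_sub, mul_add, mul_neg, h1, h2, h3]

/-- **Bookkeeping: simple positive roots ⇒ `countP = card`.**  If every positive root of `P` has multiplicity `≤ 1`, the number of
positive roots counted with multiplicity is at most (in fact equals) the number of distinct positive roots. [folklore] -/
theorem countP_posRoots_le_card_posRoots_of_rootMultiplicity_le_one (P : ℝ[X])
    (h : ∀ x : ℝ, 0 < x → P.IsRoot x → P.rootMultiplicity x ≤ 1) :
    P.roots.countP (fun x => 0 < x) ≤ (P.roots.toFinset.filter (fun x => 0 < x)).card := by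
  classical
  rw [Multiset.countP_eq_card_filter, ← Multiset.toFinset_filter]
  have hnd : (P.roots.filter (fun x => 0 < x)).Nodup := by
    rw [Multiset.nodup_iff_count_le_one]
    intro y
    rw [Multiset.count_filter]
    split_ifs with hy
    · by_cases hP : P = 0
      · simp [hP]
      · rw [count_roots]
        by_cases hr : P.IsRoot y
        · exact h y hy hr
        · rw [rootMultiplicity_eq_zero hr]; exact zero_le_one
    · exact zero_le_one
  rw [Multiset.toFinset_card_of_nodup hnd]

/-- **Under the LEFT CENTRE WITNESS every positive root of the window 4-nomial is SIMPLE.**  `0 < r` at or left of the common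
centre (`(v+w)(u+v+w)·e·r^w ≤ v(u+v)·c`), `T₂(r) < 0`, `Φ(r) > 0` (`c, e > 0`; the signs of `a, b` are not needed here); then no
positive root has multiplicity `≥ 2`. [folklore] -/
theorem fourNomial_rootMultiplicity_le_one_of_left_centre_witness {u v w : ℕ} (hu : 0 < u) (hv : 0 < v) (hw : 0 < w)
    {a b c e : ℝ} (hc : 0 < c) (he : 0 < e) {r : ℝ} (hr : 0 < r)
    (hcen : ((v : ℝ) + w) * ((u : ℝ) + v + w) * e * r ^ w ≤ (v : ℝ) * ((u : ℝ) + v) * c)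
    (hT₂r : (u : ℝ) * b - ((u : ℝ) + v) * c * r ^ v + ((u : ℝ) + v + w) * e * r ^ (v + w) < 0)
    (hΦr : 0 < (u : ℝ) * a - (v : ℝ) * c * r ^ (u + v) + ((v : ℝ) + w) * e * r ^ (u + v + w))
    {x : ℝ} (hx : 0 < x) (hroot : (C a - C b * X ^ u + C c * X ^ (u + v) - C e * X ^ (u + v + w)).IsRoot x) :
    (C a - C b * X ^ u + C c * X ^ (u + v) - C e * X ^ (u + v + w)).rootMultiplicity x ≤ 1 := by
  set P : ℝ[X] := C a - C b * X ^ u + C c * X ^ (u + v) - C e * X ^ (u + v + w) with hPdef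
  by_contra hmul
  have h2 : 1 < P.rootMultiplicity x := by omega
  -- g(x) = 0 and g'(x) = 0
  have hg0 : a - b * x ^ u + c * x ^ (u + v) - e * x ^ (u + v + w) = 0 := by
    have := hroot; rw [IsRoot.def, hPdef, eval_fourNomial] at this; exact this
  have hd0 : (derivative P).eval x = 0 := by
    have := isRoot_iterate_derivative_of_lt_rootMultiplicity h2
    simpa using this
  have hxd : x * (derivative P).eval x
      = -(b * (u : ℝ) * x ^ u) + c * ((u : ℝ) + v) * x ^ (u + v) - e * ((u : ℝ) + v + w) * x ^ (u + v + w) := by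
    rw [hPdef]; exact mul_eval_derivative_fourNomial a b c e u v w x
  rw [hd0, mul_zero] at hxd
  -- hence Φ(x) = 0 and x^u · T₂(x) = 0
  have hxu : 0 < x ^ u := pow_pos hx u
  have hΦx : (u : ℝ) * a - (v : ℝ) * c * x ^ (u + v) + ((v : ℝ) + w) * e * x ^ (u + v + w) = 0 := by
    have hpw1 : x ^ (u + v) = x ^ u * x ^ v := pow_add x u v
    have hpw2 : x ^ (u + v + w) = x ^ u * x ^ (v + w) := by rw [add_assoc, pow_add]
    nlinarith [hg0, hxd]
  have hT₂x : (u : ℝ) * b - ((u : ℝ) + v) * c * x ^ v + ((u : ℝ) + v + w) * e * x ^ (v + w) = 0 := by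
    have hpw1 : x ^ (u + v) = x ^ u * x ^ v := pow_add x u v
    have hpw2 : x ^ (u + v + w) = x ^ u * x ^ (v + w) := by rw [add_assoc, pow_add]
    have hprod : x ^ u * ((u : ℝ) * b - ((u : ℝ) + v) * c * x ^ v + ((u : ℝ) + v + w) * e * x ^ (v + w)) = 0 := by
      rw [hpw1, hpw2] at hxd; linarith
    rcases mul_eq_zero.mp hprod with h0 | h0
    · exact absurd h0 hxu.ne'
    · exact h0
  rcases le_or_gt x r with hxr | hxr
  · -- x ≤ r : Φ antitone on [0, r] gives Φ(x) ≥ Φ(r) > 0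
    have hanti := trinomial_antitoneOn_Icc (α := (u : ℝ) * a) (β := (v : ℝ) * c) (γ := ((v : ℝ) + w) * e)
      (p := u + v) (q := u + v + w) (r := r) (Nat.add_pos_left hu v) (by omega) (by positivity)
      (by
        have hqp : u + v + w - (u + v) = w := by omega
        rw [hqp]; push_cast; nlinarith [hcen])
    have hge := hanti (show x ∈ Icc (0 : ℝ) r from ⟨hx.le, hxr⟩) (show r ∈ Icc (0 : ℝ) r from ⟨hr.le, le_rfl⟩) hxr
    have : (u : ℝ) * a - (v : ℝ) * c * r ^ (u + v) + ((v : ℝ) + w) * e * r ^ (u + v + w)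
        ≤ (u : ℝ) * a - (v : ℝ) * c * x ^ (u + v) + ((v : ℝ) + w) * e * x ^ (u + v + w) := hge
    linarith
  · -- x > r : use the common centre m (m^w = v(u+v)c / ((v+w)(u+v+w)e))
    have hden : 0 < ((v : ℝ) + w) * ((u : ℝ) + v + w) * e := by positivity
    obtain ⟨m, hm, hmw⟩ := exists_pos_pow_eq (show 0 < (v : ℝ) * ((u : ℝ) + v) * c / (((v : ℝ) + w) * ((u : ℝ) + v + w) * e)
      by positivity) hw
    have hmeq : ((v : ℝ) + w) * ((u : ℝ) + v + w) * e * m ^ w = (v : ℝ) * ((u : ℝ) + v) * c := by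
      rw [hmw]; field_simp
    -- r ≤ m
    have hrm : r ≤ m := by
      have hpw : r ^ w ≤ m ^ w := by
        have := hcen; rw [← hmeq] at this
        exact le_of_mul_le_mul_left this hden
      exact le_of_pow_le_pow_left₀ hw.ne' hm.le hpw
    -- T₂ antitone on [0, m], monotone on [m, ∞)  (α = ub, β = (u+v)c, γ = (u+v+w)e, p = v, q = v+w)
    have hqp : v + w - v = w := by omega
    have hcenT1 : (((v + w : ℕ)) : ℝ) * (((u : ℝ) + v + w) * e) * m ^ (v + w - v) ≤ (v : ℝ) * (((u : ℝ) + v) * c) := by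
      rw [hqp]; push_cast; have h' := hmeq; ring_nf at h' ⊢; linarith
    have hcenT2 : (v : ℝ) * (((u : ℝ) + v) * c) ≤ (((v + w : ℕ)) : ℝ) * (((u : ℝ) + v + w) * e) * m ^ (v + w - v) := by
      rw [hqp]; push_cast; have h' := hmeq; ring_nf at h' ⊢; linarith
    have hantiT := trinomial_antitoneOn_Icc (α := (u : ℝ) * b) (β := ((u : ℝ) + v) * c) (γ := ((u : ℝ) + v + w) * e)
      (p := v) (q := v + w) (r := m) hv (by omega) (by positivity) hcenT1
    have hmonoT := trinomial_monotoneOn_Ici (α := (u : ℝ) * b) (β := ((u : ℝ) + v) * c) (γ := ((u : ℝ) + v + w) * e)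
      (p := v) (q := v + w) (r := m) hv (by omega) (by positivity) hm hcenT2
    rcases le_or_gt x m with hxm | hxm
    · -- r < x ≤ m : T₂(x) ≤ T₂(r) < 0
      have hle := hantiT (show r ∈ Icc (0 : ℝ) m from ⟨hr.le, hrm⟩) (show x ∈ Icc (0 : ℝ) m from ⟨hx.le, hxm⟩) hxr.le
      have : (u : ℝ) * b - ((u : ℝ) + v) * c * x ^ v + ((u : ℝ) + v + w) * e * x ^ (v + w)
          ≤ (u : ℝ) * b - ((u : ℝ) + v) * c * r ^ v + ((u : ℝ) + v + w) * e * r ^ (v + w) := hle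
      linarith
    · -- x > m : T₂ ≤ 0 on [r, x], so g is non-decreasing on [r, x]; but g(r) > 0 = g(x)
      have hT₂le : ∀ y ∈ Icc r x,
          (u : ℝ) * b - ((u : ℝ) + v) * c * y ^ v + ((u : ℝ) + v + w) * e * y ^ (v + w) ≤ 0 := by
        intro y hy
        rcases le_or_gt y m with hym | hym
        · have hle := hantiT (show r ∈ Icc (0 : ℝ) m from ⟨hr.le, hrm⟩) (show y ∈ Icc (0 : ℝ) m from ⟨hr.le.trans hy.1, hym⟩) hy.1
          have : (u : ℝ) * b - ((u : ℝ) + v) * c * y ^ v + ((u : ℝ) + v + w) * e * y ^ (v + w)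
              ≤ (u : ℝ) * b - ((u : ℝ) + v) * c * r ^ v + ((u : ℝ) + v + w) * e * r ^ (v + w) := hle
          linarith
        · have hle := hmonoT (show y ∈ Ici m from hym.le) (show x ∈ Ici m from hxm.le) hy.2
          have : (u : ℝ) * b - ((u : ℝ) + v) * c * y ^ v + ((u : ℝ) + v + w) * e * y ^ (v + w)
              ≤ (u : ℝ) * b - ((u : ℝ) + v) * c * x ^ v + ((u : ℝ) + v + w) * e * x ^ (v + w) := hle
          linarith
      -- g monotone on [r, x]
      have hmono : MonotoneOn (fun y : ℝ => P.eval y) (Icc r x) := by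
        apply monotoneOn_of_deriv_nonneg (convex_Icc r x)
        · exact (P.continuous).continuousOn
        · intro y _; exact (P.differentiableAt).differentiableWithinAt
        · intro y hy
          rw [interior_Icc] at hy
          have hy0 : 0 < y := hr.trans hy.1
          rw [Polynomial.deriv]
          have hyd : y * (derivative P).eval y
              = -(b * (u : ℝ) * y ^ u) + c * ((u : ℝ) + v) * y ^ (u + v) - e * ((u : ℝ) + v + w) * y ^ (u + v + w) := by
            rw [hPdef]; exact mul_eval_derivative_fourNomial a b c e u v w y
          have hpw1 : y ^ (u + v) = y ^ u * y ^ v := pow_add y u v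
          have hpw2 : y ^ (u + v + w) = y ^ u * y ^ (v + w) := by rw [add_assoc, pow_add]
          have hT := hT₂le y ⟨hy.1.le, hy.2.le⟩
          have hyu : 0 < y ^ u := pow_pos hy0 u
          -- y * P'(y) = - y^u * T₂(y) ≥ 0
          have hprod : y * (derivative P).eval y
              = -(y ^ u * ((u : ℝ) * b - ((u : ℝ) + v) * c * y ^ v + ((u : ℝ) + v + w) * e * y ^ (v + w))) := by
            rw [hyd, hpw1, hpw2]; ring
          have hnn : 0 ≤ y * (derivative P).eval y := by
            rw [hprod, ← mul_neg]; exact mul_nonneg hyu.le (neg_nonneg.mpr hT)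
          exact nonneg_of_mul_nonneg_right hnn hy0
      have hPr : P.eval r ≤ P.eval x := hmono ⟨le_rfl, hxr.le⟩ ⟨hxr.le, le_rfl⟩ hxr.le
      have hPx : P.eval x = 0 := by rw [hPdef, eval_fourNomial]; exact hg0
      have hPr' : P.eval r = a - b * r ^ u + c * r ^ (u + v) - e * r ^ (u + v + w) := by rw [hPdef, eval_fourNomial]
      -- u g(r) = Φ(r) - r^u T₂(r) > 0
      have hru : 0 < r ^ u := pow_pos hr u
      have hpw1 : r ^ (u + v) = r ^ u * r ^ v := pow_add r u v
      have hpw2 : r ^ (u + v + w) = r ^ u * r ^ (v + w) := by rw [add_assoc, pow_add]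
      have hgr : 0 < a - b * r ^ u + c * r ^ (u + v) - e * r ^ (u + v + w) := by
        have hid : (u : ℝ) * (a - b * r ^ u + c * r ^ (u + v) - e * r ^ (u + v + w))
            = ((u : ℝ) * a - (v : ℝ) * c * r ^ (u + v) + ((v : ℝ) + w) * e * r ^ (u + v + w))
              - r ^ u * ((u : ℝ) * b - ((u : ℝ) + v) * c * r ^ v + ((u : ℝ) + v + w) * e * r ^ (v + w)) := by
          rw [hpw1, hpw2]; ring
        have hpos : 0 < (u : ℝ) * (a - b * r ^ u + c * r ^ (u + v) - e * r ^ (u + v + w)) := by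
          have hm' : 0 < r ^ u * -((u : ℝ) * b - ((u : ℝ) + v) * c * r ^ v + ((u : ℝ) + v + w) * e * r ^ (v + w)) :=
            mul_pos hru (neg_pos.mpr hT₂r)
          rw [hid, sub_eq_add_neg, ← mul_neg]; exact add_pos hΦr hm'
        have hu' : (0 : ℝ) < u := by exact_mod_cast hu
        exact lt_of_mul_lt_mul_left (by rw [mul_zero]; exact hpos) hu'.le
      linarith

/-- **WINDOW-4 LEFT CENTRE-WITNESS ROW, WITH MULTIPLICITY.**  Same witness as
`fourNomial_card_posRoots_le_two_of_left_centre_witness` (plus `0 < c`); the window 4-nomial has at most two positive roots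
COUNTED WITH MULTIPLICITY. [folklore] -/
theorem fourNomial_countP_posRoots_le_two_of_left_centre_witness {u v w : ℕ} (hu : 0 < u) (hv : 0 < v) (hw : 0 < w)
    {a b c e : ℝ} (ha : 0 < a) (hb : 0 < b) (hc : 0 < c) (he : 0 < e) {r : ℝ} (hr : 0 < r)
    (hcen : ((v : ℝ) + w) * ((u : ℝ) + v + w) * e * r ^ w ≤ (v : ℝ) * ((u : ℝ) + v) * c)
    (hT₂r : (u : ℝ) * b - ((u : ℝ) + v) * c * r ^ v + ((u : ℝ) + v + w) * e * r ^ (v + w) < 0)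
    (hΦr : 0 < (u : ℝ) * a - (v : ℝ) * c * r ^ (u + v) + ((v : ℝ) + w) * e * r ^ (u + v + w)) :
    (C a - C b * X ^ u + C c * X ^ (u + v) - C e * X ^ (u + v + w)).roots.countP (fun x => 0 < x) ≤ 2 := by
  refine le_trans (countP_posRoots_le_card_posRoots_of_rootMultiplicity_le_one _ ?_)
    (fourNomial_card_posRoots_le_two_of_left_centre_witness hu hv hw ha hb he hr hcen hT₂r hΦr)
  intro x hx hroot
  exact fourNomial_rootMultiplicity_le_one_of_left_centre_witness hu hv hw hc he hr hcen hT₂r hΦr hx hroot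

/-- **WINDOW-4 PARAMETRIC LEFT ROW, WITH MULTIPLICITY.**  `u, v, w ≥ 1`, `a, b, c, e > 0`, `λ` real,
`ρ := λ·u·b/((u+v)·c) > 0`.  If `ρ^w·((v+w)(u+v+w)e)^v ≤ (v(u+v)c)^v`, `((u+v+w)e)^v·ρ^(v+w) < ((λ−1)ub)^v` and
`(vc)^v·ρ^(u+v) < (ua)^v`, the window 4-nomial has at most two positive roots COUNTED WITH MULTIPLICITY.  Read contrapositively:
three positive roots with multiplicity ⇒ the disjunction of the negated monomial rows (a log-linear two-way split). [folklore] -/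
theorem fourNomial_countP_posRoots_le_two_of_left_param {u v w : ℕ} (hu : 0 < u) (hv : 0 < v) (hw : 0 < w)
    {a b c e lam : ℝ} (ha : 0 < a) (hb : 0 < b) (hc : 0 < c) (he : 0 < e) {ρ : ℝ} (hρ : 0 < ρ)
    (hρdef : ρ * (((u : ℝ) + v) * c) = lam * ((u : ℝ) * b))
    (h1 : ρ ^ w * ((((v : ℝ) + w) * ((u : ℝ) + v + w) * e)) ^ v ≤ ((v : ℝ) * ((u : ℝ) + v) * c) ^ v)
    (h2 : (((u : ℝ) + v + w) * e) ^ v * ρ ^ (v + w) < ((lam - 1) * ((u : ℝ) * b)) ^ v)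
    (h2' : 0 ≤ (lam - 1) * ((u : ℝ) * b))
    (h3 : ((v : ℝ) * c) ^ v * ρ ^ (u + v) < ((u : ℝ) * a) ^ v) :
    (C a - C b * X ^ u + C c * X ^ (u + v) - C e * X ^ (u + v + w)).roots.countP (fun x => 0 < x) ≤ 2 := by
  obtain ⟨r, hr, hrv⟩ := exists_pos_pow_eq hρ hv
  have hvne : v ≠ 0 := hv.ne'
  have hrw : (r ^ w) ^ v = ρ ^ w := by rw [← pow_mul, mul_comm, pow_mul, hrv]
  have hrvw : (r ^ (v + w)) ^ v = ρ ^ (v + w) := by rw [← pow_mul, mul_comm, pow_mul, hrv]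
  have hruv : (r ^ (u + v)) ^ v = ρ ^ (u + v) := by rw [← pow_mul, mul_comm, pow_mul, hrv]
  have hcen : ((v : ℝ) + w) * ((u : ℝ) + v + w) * e * r ^ w ≤ (v : ℝ) * ((u : ℝ) + v) * c := by
    have hx : 0 ≤ ((v : ℝ) + w) * ((u : ℝ) + v + w) * e * r ^ w := by positivity
    have hy : 0 ≤ (v : ℝ) * ((u : ℝ) + v) * c := by positivity
    refine le_of_pow_le_pow_left' hx hy hvne ?_
    calc (((v : ℝ) + w) * ((u : ℝ) + v + w) * e * r ^ w) ^ v
        = ρ ^ w * ((((v : ℝ) + w) * ((u : ℝ) + v + w) * e)) ^ v := by rw [mul_pow, hrw, mul_comm]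
      _ ≤ ((v : ℝ) * ((u : ℝ) + v) * c) ^ v := h1
  have hT : (u : ℝ) * b - ((u : ℝ) + v) * c * r ^ v + ((u : ℝ) + v + w) * e * r ^ (v + w) < 0 := by
    have hlt : ((u : ℝ) + v + w) * e * r ^ (v + w) < (lam - 1) * ((u : ℝ) * b) := by
      refine lt_of_pow_lt_pow_left' h2' v ?_
      calc (((u : ℝ) + v + w) * e * r ^ (v + w)) ^ v
          = (((u : ℝ) + v + w) * e) ^ v * ρ ^ (v + w) := by rw [mul_pow, hrvw]
        _ < ((lam - 1) * ((u : ℝ) * b)) ^ v := h2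
    have hmid : ((u : ℝ) + v) * c * r ^ v = lam * ((u : ℝ) * b) := by rw [hrv, mul_comm, hρdef]
    nlinarith
  have hΦ : 0 < (u : ℝ) * a - (v : ℝ) * c * r ^ (u + v) + ((v : ℝ) + w) * e * r ^ (u + v + w) := by
    have hlt : (v : ℝ) * c * r ^ (u + v) < (u : ℝ) * a := by
      refine lt_of_pow_lt_pow_left' (by positivity) v ?_
      calc ((v : ℝ) * c * r ^ (u + v)) ^ v = ((v : ℝ) * c) ^ v * ρ ^ (u + v) := by rw [mul_pow, hruv]
        _ < ((u : ℝ) * a) ^ v := h3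
    have hpos : 0 < ((v : ℝ) + w) * e * r ^ (u + v + w) := by positivity
    linarith
  exact fourNomial_countP_posRoots_le_two_of_left_centre_witness hu hv hw ha hb hc he hr hcen hT hΦ

end Summit.ValiantsHypothesis.ValiantsHypothesis.Theorems.LacunarySymmetroidMatrixDescartes.Census
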